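import Mathlib.CategoryTheory.EssentialImage
import Mathlib.CategoryTheory.NatIso
import HarnessLib

/-!
# Frobenioids I, Corollary 5.4 (strong 1-uniqueness at THE data): rigidity along an essentially
# surjective functor — the generic reduction (sub-DAG row C54-core-arith, file 1 of 5)

Mochizuki, *The geometry of Frobenioids I: the general theory*, Kyushu J. Math. **62** (2008) 293–400,
Corollary 5.4, kurims p. 104 ll. 1–9: "there exists a 1-unique functor `Ψ^rlf : C₁^rlf → C₂^rlf` that fits
into a 1-commutative diagram […]". [cite: MochizukiFrdI2008, Cor. 5.4 p.104]

The as-typed STRONG 1-uniqueness clause of `PreFrobenioid.Cor54` at THE data is reduced in the tree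
(`Cor54SubStrongUniqueReduction.lean`, `FrdI.Cor54Sub.strongUnique_of_rigidAlong_untrToRlf`, seat
abc-iut-w5-d227) to RIGIDITY ALONG the model-level realification functor `G = untrToRlf`:
`∀ T, Nonempty (G ⋙ T ≅ G) → Nonempty (T ≅ 𝟭 _)`. When `G` is full and essentially surjective this is
`FrdI.Cor54Sub.nonempty_iso_of_isoWhiskerLeft`; `untrToRlf` is NOT full (real divisors and real units are
not in its image), so this PROOF-ONLY file (seat abc-iut-w5-d048, L1-lead R111 (2); no definitions, Mathlib
only) isolates exactly what is needed beyond essential surjectivity.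

For a family of isomorphisms `η_a : T (G a) ≅ G a` natural in the morphisms `G f` (e.g. the components of
some `θ : G ⋙ T ≅ G`), the `η`-CONJUGATE of `T` on a morphism `h : G a ⟶ G a'` BETWEEN `G`-IMAGE OBJECTS is
`ρ(h) := η_a⁻¹ ≫ T h ≫ η_{a'}`:

* `FrdI.Cor54Sub.conj_comp`, `conj_id`, `conj_map`, `conj_eq_self_iff` — `ρ` is functorial and fixes
  the morphisms `G f`;
* `FrdI.Cor54Sub.nonempty_iso_id_of_essSurj_of_conj_eq` — if `G` is essentially surjective and `ρ(h) = h`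
  for EVERY `h` between image objects, then `T ≅ 𝟭` (components `T e⁻¹ ≫ η_a ≫ e` along chosen
  `e : G a ≅ Y`; naturality at `g : Y ⟶ Y'` is the hypothesis at `h := e ≫ g ≫ e'⁻¹`);
* **`FrdI.Cor54Sub.rigidAlong_of_essSurj_of_homRigid`** — rigidity along `G` in the shape consumed by
  `strongUnique_of_rigidAlong_untrToRlf`, from (a′) essential surjectivity of `G` and (b′) HOM-RIGIDITY:
  every identity-on-objects functorial self-map `ρ` of the morphisms between `G`-image objects which fixes
  the morphisms `G f` is the identity. (b′) no longer mentions `T`: it is a property of the (non-full)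
  subcategory `G(A) ⊆ E`, attacked for the arithmetic Frobenioid `C_{K/F}` in files 3–4 of this row;
* `FrdI.Cor54Sub.exists_conj_eq_of_iso_id` — sharpness: if `T ≅ 𝟭` then some natural family `η` has
  `ρ = id`.

Pure category theory; nothing here bears on [IUTchIII] Cor. 3.12.
-/

namespace Literature.AlgebraicGeometry.Frobenioids

namespace FrdI.Cor54Sub

open CategoryTheory

universe v₁ v₂ u₁ u₂

variable {A : Type u₁} [Category.{v₁} A] {E : Type u₂} [Category.{v₂} E]
  (G : A ⥤ E) (T : E ⥤ E) (η : ∀ a : A, T.obj (G.obj a) ≅ G.obj a)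

/-! ### The conjugate of `T` on morphisms between `G`-image objects -/

/-- `ρ(h ≫ k) = ρ(h) ≫ ρ(k)` for the conjugate `ρ(h) = η_a⁻¹ ≫ T h ≫ η_{a'}` of `T`.
[cite: MochizukiFrdI2008, Cor. 5.4 p.104] -/
theorem conj_comp {a a' a'' : A} (h : G.obj a ⟶ G.obj a') (k : G.obj a' ⟶ G.obj a'') :
    (η a).inv ≫ T.map (h ≫ k) ≫ (η a'').hom =
      ((η a).inv ≫ T.map h ≫ (η a').hom) ≫ ((η a').inv ≫ T.map k ≫ (η a'').hom) := by
  simp only [Functor.map_comp, Category.assoc, Iso.hom_inv_id_assoc]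

/-- `ρ(𝟙) = 𝟙`. [cite: MochizukiFrdI2008, Cor. 5.4 p.104] -/
theorem conj_id (a : A) : (η a).inv ≫ T.map (𝟙 (G.obj a)) ≫ (η a).hom = 𝟙 (G.obj a) := by
  simp only [Functor.map_id, Category.id_comp, Iso.inv_hom_id]

/-- `ρ(G f) = G f` when `η` is natural in the morphisms `G f`: the conjugate fixes the image of `G`.
[cite: MochizukiFrdI2008, Cor. 5.4 p.104] -/
theorem conj_map (hη : ∀ ⦃a a' : A⦄ (f : a ⟶ a'), T.map (G.map f) ≫ (η a').hom = (η a).hom ≫ G.map f)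
    {a a' : A} (f : a ⟶ a') : (η a).inv ≫ T.map (G.map f) ≫ (η a').hom = G.map f := by
  rw [hη, Iso.inv_hom_id_assoc]

/-- `ρ(h) = h` iff `T h ≫ η_{a'} = η_a ≫ h` (the naturality square of `η` at `h`, which in general is NOT
of the form `G f`). [cite: MochizukiFrdI2008, Cor. 5.4 p.104] -/
theorem conj_eq_self_iff {a a' : A} (h : G.obj a ⟶ G.obj a') :
    (η a).inv ≫ T.map h ≫ (η a').hom = h ↔ T.map h ≫ (η a').hom = (η a).hom ≫ h := by
  constructor
  · intro hh
    have := congrArg (fun k => (η a).hom ≫ k) hh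
    simpa only [Iso.hom_inv_id_assoc] using this
  · intro hh
    rw [hh, Iso.inv_hom_id_assoc]

/-- `ρ(e.hom) ≫ ρ(e.inv) = 𝟙` for an isomorphism `e` between image objects.
[cite: MochizukiFrdI2008, Cor. 5.4 p.104] -/
theorem conj_hom_comp_conj_inv {a a' : A} (e : G.obj a ≅ G.obj a') :
    ((η a).inv ≫ T.map e.hom ≫ (η a').hom) ≫ ((η a').inv ≫ T.map e.inv ≫ (η a).hom) =
      𝟙 (G.obj a) := by
  rw [← conj_comp, Iso.hom_inv_id, conj_id]

/-! ### `T ≅ 𝟭` from essential surjectivity and `ρ = id` -/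

/-- **`T ≅ 𝟭` from essential surjectivity of `G` and `ρ = id` on the morphisms between `G`-image
objects.** [cite: MochizukiFrdI2008, Cor. 5.4 p.104] -/
theorem nonempty_iso_id_of_essSurj_of_conj_eq [G.EssSurj]
    (hρ : ∀ ⦃a a' : A⦄ (h : G.obj a ⟶ G.obj a'), (η a).inv ≫ T.map h ≫ (η a').hom = h) :
    Nonempty (T ≅ 𝟭 E) := by
  refine ⟨NatIso.ofComponents
    (fun Y => T.mapIso (G.objObjPreimageIso Y).symm ≪≫ η (G.objPreimage Y) ≪≫ G.objObjPreimageIso Y)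
    ?_⟩
  intro Y Y' g
  -- restate the naturality square with all objects in the form `T.obj _` / `G.obj _` / `Y`
  change T.map g ≫ T.map (G.objObjPreimageIso Y').inv ≫ (η (G.objPreimage Y')).hom ≫
      (G.objObjPreimageIso Y').hom =
    (T.map (G.objObjPreimageIso Y).inv ≫ (η (G.objPreimage Y)).hom ≫ (G.objObjPreimageIso Y).hom) ≫ g
  -- the morphism between image objects underlying `g`
  set h : G.obj (G.objPreimage Y) ⟶ G.obj (G.objPreimage Y') :=
    (G.objObjPreimageIso Y).hom ≫ g ≫ (G.objObjPreimageIso Y').inv with hh_def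
  have hh : T.map h ≫ (η (G.objPreimage Y')).hom = (η (G.objPreimage Y)).hom ≫ h :=
    (conj_eq_self_iff G T η h).mp (hρ h)
  have hg : g = (G.objObjPreimageIso Y).inv ≫ h ≫ (G.objObjPreimageIso Y').hom := by
    simp only [hh_def, Category.assoc, Iso.inv_hom_id, Category.comp_id, Iso.inv_hom_id_assoc]
  rw [hg]
  simp only [Category.assoc, Functor.map_comp, Iso.map_hom_inv_id_assoc]
  rw [reassoc_of% hh, Iso.hom_inv_id_assoc]

/-- The same with essential surjectivity given as a bare existence statement.
[cite: MochizukiFrdI2008, Cor. 5.4 p.104] -/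
theorem nonempty_iso_id_of_exists_iso_of_conj_eq (hess : ∀ Y : E, ∃ a : A, Nonempty (G.obj a ≅ Y))
    (hρ : ∀ ⦃a a' : A⦄ (h : G.obj a ⟶ G.obj a'), (η a).inv ≫ T.map h ≫ (η a').hom = h) :
    Nonempty (T ≅ 𝟭 E) := by
  haveI : G.EssSurj := ⟨fun Y => hess Y⟩
  exact nonempty_iso_id_of_essSurj_of_conj_eq G T η hρ

/-! ### Rigidity along `G` from hom-rigidity of the image -/

/-- **Rigidity along an essentially surjective `G` from HOM-RIGIDITY of its image.** Suppose `G` is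
essentially surjective and every functorial self-map `ρ` of the morphisms between `G`-image objects
(`ρ(h ≫ k) = ρ(h) ≫ ρ(k)`) fixing the morphisms `G f` is the identity. Then every endofunctor `T` with
`G ⋙ T ≅ G` is `≅ 𝟭` — the hypothesis `hrig` of `FrdI.Cor54Sub.strongUnique_of_rigidAlong_untrToRlf`.
Proof: apply hom-rigidity to the `θ`-conjugate of `T`. [cite: MochizukiFrdI2008, Cor. 5.4 p.104] -/
theorem rigidAlong_of_essSurj_of_homRigid [G.EssSurj]
    (H : ∀ ρ : ∀ ⦃a a' : A⦄, (G.obj a ⟶ G.obj a') → (G.obj a ⟶ G.obj a'),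
      (∀ ⦃a a' a'' : A⦄ (h : G.obj a ⟶ G.obj a') (k : G.obj a' ⟶ G.obj a''), ρ (h ≫ k) = ρ h ≫ ρ k) →
      (∀ ⦃a a' : A⦄ (f : a ⟶ a'), ρ (G.map f) = G.map f) →
        ∀ ⦃a a' : A⦄ (h : G.obj a ⟶ G.obj a'), ρ h = h) :
    ∀ T : E ⥤ E, Nonempty (G ⋙ T ≅ G) → Nonempty (T ≅ 𝟭 E) := by
  rintro T ⟨θ⟩
  -- the components of `θ`, retyped at `T (G a)` (definitionally `(G ⋙ T) a`)
  let η : ∀ a : A, T.obj (G.obj a) ≅ G.obj a := fun a =>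
    ⟨θ.hom.app a, θ.inv.app a, θ.hom_inv_id_app a, θ.inv_hom_id_app a⟩
  have hη : ∀ ⦃a a' : A⦄ (f : a ⟶ a'), T.map (G.map f) ≫ (η a').hom = (η a).hom ≫ G.map f :=
    fun a a' f => θ.hom.naturality f
  refine nonempty_iso_id_of_essSurj_of_conj_eq G T η ?_
  exact H (fun a a' h => (η a).inv ≫ T.map h ≫ (η a').hom) (fun a a' a'' h k => conj_comp G T η h k)
    (fun a a' f => conj_map G T η hη f)

/-- Variant with essential surjectivity as a bare existence statement.
[cite: MochizukiFrdI2008, Cor. 5.4 p.104] -/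
theorem rigidAlong_of_exists_iso_of_homRigid (hess : ∀ Y : E, ∃ a : A, Nonempty (G.obj a ≅ Y))
    (H : ∀ ρ : ∀ ⦃a a' : A⦄, (G.obj a ⟶ G.obj a') → (G.obj a ⟶ G.obj a'),
      (∀ ⦃a a' a'' : A⦄ (h : G.obj a ⟶ G.obj a') (k : G.obj a' ⟶ G.obj a''), ρ (h ≫ k) = ρ h ≫ ρ k) →
      (∀ ⦃a a' : A⦄ (f : a ⟶ a'), ρ (G.map f) = G.map f) →
        ∀ ⦃a a' : A⦄ (h : G.obj a ⟶ G.obj a'), ρ h = h) :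
    ∀ T : E ⥤ E, Nonempty (G ⋙ T ≅ G) → Nonempty (T ≅ 𝟭 E) := by
  haveI : G.EssSurj := ⟨fun Y => hess Y⟩
  exact rigidAlong_of_essSurj_of_homRigid G H

/-- Under hom-rigidity a functorial `ρ` fixing the `G f` also fixes identities (bookkeeping: `ρ 𝟙 = 𝟙`
is automatic from `ρ (G 𝟙) = G 𝟙`). [cite: MochizukiFrdI2008, Cor. 5.4 p.104] -/
theorem homMap_id (ρ : ∀ ⦃a a' : A⦄, (G.obj a ⟶ G.obj a') → (G.obj a ⟶ G.obj a'))
    (hmap : ∀ ⦃a a' : A⦄ (f : a ⟶ a'), ρ (G.map f) = G.map f) (a : A) :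
    ρ (𝟙 (G.obj a)) = 𝟙 (G.obj a) := by
  rw [← G.map_id]
  exact hmap (𝟙 a)

/-- A functorial `ρ` fixing the `G f` maps an isomorphism `e` between image objects to an isomorphism
whose inverse is `ρ e⁻¹` (`ρ e ≫ ρ e⁻¹ = 𝟙`). [cite: MochizukiFrdI2008, Cor. 5.4 p.104] -/
theorem homMap_hom_comp_homMap_inv (ρ : ∀ ⦃a a' : A⦄, (G.obj a ⟶ G.obj a') → (G.obj a ⟶ G.obj a'))
    (hcomp : ∀ ⦃a a' a'' : A⦄ (h : G.obj a ⟶ G.obj a') (k : G.obj a' ⟶ G.obj a''),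
      ρ (h ≫ k) = ρ h ≫ ρ k)
    (hmap : ∀ ⦃a a' : A⦄ (f : a ⟶ a'), ρ (G.map f) = G.map f) {a a' : A} (e : G.obj a ≅ G.obj a') :
    ρ e.hom ≫ ρ e.inv = 𝟙 (G.obj a) := by
  rw [← hcomp, Iso.hom_inv_id, homMap_id G ρ hmap]

/-- Sharpness of the reduction: if `T ≅ 𝟭` then for the natural family `η_a := τ_{G a}` the conjugate is
the identity on all morphisms between image objects. [cite: MochizukiFrdI2008, Cor. 5.4 p.104] -/
theorem exists_conj_eq_of_iso_id (τ : T ≅ 𝟭 E) :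
    ∃ η : ∀ a : A, T.obj (G.obj a) ≅ G.obj a,
      (∀ ⦃a a' : A⦄ (f : a ⟶ a'), T.map (G.map f) ≫ (η a').hom = (η a).hom ≫ G.map f) ∧
      ∀ ⦃a a' : A⦄ (h : G.obj a ⟶ G.obj a'), (η a).inv ≫ T.map h ≫ (η a').hom = h := by
  -- the components of `τ` at image objects, retyped at `G a` (definitionally `(𝟭 E) (G a)`)
  let η : ∀ a : A, T.obj (G.obj a) ≅ G.obj a := fun a =>
    ⟨τ.hom.app (G.obj a), τ.inv.app (G.obj a), τ.hom_inv_id_app (G.obj a), τ.inv_hom_id_app (G.obj a)⟩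
  have hnat : ∀ {X X' : E} (k : X ⟶ X'),
      T.map k ≫ (show T.obj X' ⟶ X' from τ.hom.app X') = (show T.obj X ⟶ X from τ.hom.app X) ≫ k :=
    fun k => τ.hom.naturality k
  refine ⟨η, fun a a' f => hnat (G.map f), fun a a' h => ?_⟩
  have hn : T.map h ≫ (η a').hom = (η a).hom ≫ h := hnat h
  rw [hn, Iso.inv_hom_id_assoc]

end FrdI.Cor54Sub

end Literature.AlgebraicGeometry.Frobenioids
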